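/-
Copyright (c) 2026 the pub-hodgecm-mathlib formalisation cell (harness21).  Prover seat hodgecm-mathlib-F0P3a-p01 (g32), req620 Track A «(D-RAM) FOUR-FRAME» squad
(unit U3_Laws, (KMS) road «MODULO κ-STAGE B», κ-ASSEMBLER «UNSIGNED PAIR», dealer LH4-plan (g11) WORD #53 (1) ∕ #56 (b): THE (κ-B₀) CHILD `stub_U3_kappaCount_typeZero`
(tree `Cruxes/H413/Lines/F0_P3c_DyRamFourFrame_U3_Laws.lean` ED. 10 :487) PAID — the payer-modulo-box-sum (this seat) fed LH4-p14 (g3)'s ★ κ-BOX-SUM identity).  2026-09-04.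
-/
import Summits.HodgeConjecture.HodgeConjecture.Theorems.F0P3cDyRamKappaCountTypeZero   -- (this seat): `kappaCount_typeZero_of_boxSum` — (κ-B₀) modulo the box-sum identity; brings every ★ type-0 κ-socket
import Summits.HodgeConjecture.HodgeConjecture.Theorems.F0P3cDyRamKappaCountBoxSum    -- ★ (LH4-p14 (g3)): `sum_box_kappa_eq_typeZero` — «κ-BOX-SUM», the finite-sum arithmetic of the κ-table over the box
import HarnessLib

/-!
# Crux `H413`, line LH4 «(D-RAM) FOUR-FRAME» road — unit U3_Laws (iii), (KMS) road «MODULO κ-STAGE B»: THE (κ-B₀) CHILD PAID —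
# `|Σᶠ_{M ∈ 𝓛₀(T), dualisable} κ₀,ᵢ(M)·w(M)| = ampl(q, k, B)∕4`, unconditionally

Cell `hodgecm-mathlib` (D-0151), FLOOR 0, crux item H413 = `stmt-HodgeConjecture-24833`, route of record `HCCMUnconditional`; squad F0∕P3c∕LH4 (req618∕req620); registered stub served:
`F0P3cDyRamFourFrameU3.stub_U3_kappaCount_typeZero` ((κ-B₀), U3 ED. 10 :487 — the `hBκ10` binder of ★ Fκ5 ED. 2 `kappaModelSum_of_kappaStageB_complete`).  THEOREMS ONLY (no `def`,
no instance, no notation, no `sorry`, default heartbeats); lane `--supports stmt-HodgeConjecture-24833 --as helper` (count-neutral).  ONE theorem, whose TYPE is the (κ-B₀) sentence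
TOKEN FOR TOKEN (`[CompleteSpace K]`, `depthOfRecord d`, `shiftR d t`, `ampl`), proved by ONE application: this seat's ★ `kappaCount_typeZero_of_boxSum` (the ★ B10 road re-run with the
signed summand `κ₀,ᵢ·w` — ★ PART 1 partition, the seven ★ type-0 κ-sockets T p856661 ∕ G1 p856706 ∕ G2–G3 p856834 ∕ H p856750 at σ-fixed glue witnesses ★ p856808, `0` off the ★ B3
shape list, `|sign token| = 1`, `max(0, q^k − q^{k−B}) = q^k − q^{k−B′}`) fed LH4-p14 (g3)'s ★ «κ-BOX-SUM» `F0P3cDyRamKappaCountBoxSum.sum_box_kappa_eq_typeZero` (the on-branch block and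
the deep tubes telescope, the boundary tubes eat them from below, the alive glue cells tile `[k − B′, k − 1]` with one sign).  So the U3 pay line of the next edition is the single token
`Summit.HodgeConjecture.HodgeConjecture.Cruxes.H413.F0P3cDyRamKappaCountTypeZeroPaid.kappaCount_typeZero`.
HONEST LABEL.  Count-neutral (`--supports`); this settles the UNSIGNED type-0 κ-census child of U3 only — (κ-B₂), the signed κS leaves (under the (R-22) re-lettering) and (KMS)
remain PROVER TARGETS until their payers land; nothing printed is asserted; `HC_CM` is proved only modulo the 7 printed citations (2 remaining named inputs: hLiu418 =
`stmt-HodgeConjecture-24832`, h413 = `stmt-HodgeConjecture-24833`) until rung 0 closes.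

## References
* [Kottwitz1986BaseChangeUnits] R. E. Kottwitz, *Base change for unit elements of Hecke algebras*, Compositio Math. 60 (1986), §1 pp. 240–241 (κ-orbital integrals of units as
  signed lattice counts modulo the torus).
* [Rogawski1990] J. D. Rogawski, *Automorphic Representations of Unitary Groups in Three Variables*, Ann. of Math. Stud. 123 (1990), §4.9 Prop. 4.9.1 (a) p. 55, §4.10 p. 58.
* [LanglandsShelstad1987] R. P. Langlands, D. Shelstad, *On the definition of transfer factors*, Math. Ann. 278 (1987), §3 (κ as a character of `H¹(F, T)`).
-/

set_option autoImplicit false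

noncomputable section

namespace Summit.HodgeConjecture.HodgeConjecture.Cruxes.H413.F0P3cDyRamKappaCountTypeZeroPaid

open Literature.NumberTheory.Automorphic Literature.NumberTheory.Automorphic.HermitianLattice
open Literature.NumberTheory.Automorphic.UnitaryLatticeTree Literature.NumberTheory.Automorphic.UnitaryThreeFourFrame
open Literature.NumberTheory.LocalFields Literature.NumberTheory.LocalFields.WildQuadraticDatum
open Summit.HodgeConjecture.HodgeConjecture.Cruxes.H413.F0P3cDyRamFourFrameLawDefsR (shiftR)
open Summit.HodgeConjecture.HodgeConjecture.Cruxes.H413.F0P3cDyRamDiagonalTorusDefs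
open Summit.HodgeConjecture.HodgeConjecture.Cruxes.H413.F0P3cDyRamDiagonalStrataDefs
open Summit.HodgeConjecture.HodgeConjecture.Cruxes.H413.F0P3cDyRamDiagonalKappaCountDefs
open Summit.HodgeConjecture.HodgeConjecture.Cruxes.H413.F0P3cDyRamKappaCountTypeZero (kappaCount_typeZero_of_boxSum)
open Summit.HodgeConjecture.HodgeConjecture.Cruxes.H413.F0P3cDyRamKappaCountBoxSum (sum_box_kappa_eq_typeZero)
open scoped Valued WithZero Matrix MatrixGroups

/-! ## §1  The (κ-B₀) child, unconditionally -/

/-- **(κ-B₀) «TYPE 0, UNSIGNED» — THE κ-WEIGHTED TYPE-0 CENSUS LAW OF THE DIAGONAL MODEL.**  For every wild ramified quadratic datum on a complete field with finite residue field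
(`|2| < 1`), every element datum `(α, β; n₁, n₂, n₃)` at the depth of record, `T = diag(α, β, 1)`, `2k + d = n₁ + n₂ + n₃ + 2`, every slot `i` and `2B = nᵢ − d + 2 − 2·shiftR d t`:
`|Σᶠ_{M ∈ 𝓛₀(T), dualisable} κ₀,ᵢ(M)·w(M)| = ampl(q, k, B)∕4` — the sentence of `stub_U3_kappaCount_typeZero` (U3 ED. 10 :487) TOKEN FOR TOKEN, by this seat's ★
`kappaCount_typeZero_of_boxSum` at LH4-p14 (g3)'s ★ `sum_box_kappa_eq_typeZero`.
[cite: Kottwitz1986BaseChangeUnits, §1 pp. 240–241] [cite: Rogawski1990, §4.9 Prop. 4.9.1 (a) p. 55; §4.10 p. 58] [cite: LanglandsShelstad1987, §3] -/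
theorem kappaCount_typeZero :
    ∀ {K : Type} [Field K] [Valued K ℤᵐ⁰] [CompleteSpace K] [Fintype 𝓀[K]] {σ : K →+* K} {ϖ : K} {d t : ℕ}, IsRamifiedQuadraticDatum σ ϖ d t →
      Valued.v (2 : K) < 1 → ∀ {α β : K} {n₁ n₂ n₃ : ℕ}, IsElementDatum σ ϖ (depthOfRecord d) α β n₁ n₂ n₃ →
      ∀ (T : GL (Fin 3) K), (T : Matrix (Fin 3) (Fin 3) K) = Matrix.diagonal ![α, β, 1] → ∀ (k : ℕ), 2 * k + d = n₁ + n₂ + n₃ + 2 →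
      ∀ (i : Fin 3) (B : ℤ), 2 * B = ((![n₁, n₂, n₃] : Fin 3 → ℕ) i : ℤ) - d + 2 - 2 * shiftR d t →
        |∑ᶠ M ∈ {M : Submodule 𝒪[K] (Fin 3 → K) | M ∈ normalisedStableLattices T ∧ IsDualisableLattice σ ϖ M},
            (kappaCount σ ϖ 0 i M : ℚ) * stabiliserWeight σ M| = ampl (Fintype.card 𝓀[K]) k B / 4 :=
  kappaCount_typeZero_of_boxSum sum_box_kappa_eq_typeZero

end Summit.HodgeConjecture.HodgeConjecture.Cruxes.H413.F0P3cDyRamKappaCountTypeZeroPaid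

end
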